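import Literature.MathematicalPhysics.QuantumFieldTheory.HeppBound
import Literature.Combinatorics.Matroid.HeppBoundProofs
import Literature.Combinatorics.Matroid.HeppBoundDuality
import HarnessLib

/-!
# The flag formula for primitive-divergent graphs, unconditionally (Panzer 2022, Prop. 3.2)

With Panzer's flag formula `Panzer2022_prop_3_2` now a theorem of the tree
(`Literature/Combinatorics/Matroid/HeppBoundProofs.lean`), the bridge
`graphHeppBoundDim_eq_graphHeppFlagSum` of `QuantumFieldTheory/HeppBound.lean` becomes
unconditional for the graphs of the route `KontsevichZagierPeriods/PhiFourLaboratory`: for a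
**primitive-divergent** edge list (Brown 2009, Def. 4: `N = 2 h₁(G)` and `|γ| > 2 h₁(γ)` for
every non-empty proper edge set `γ`) the cycle matroid is connected (a separation `E = A ⊔ B`
would give `0 = ω(E) = ω(A) + ω(B) > 0`; Panzer 2022, proof of Lemma 2.16), unit indices in
`D = 4` lie off every pole (`ω(γ) = |γ| - 2 h₁(γ) > 0`, the convergence cone of Prop. 2.9), and
hence **the route's inlined bridgeless-flag sum IS the Hepp bound `H(G)` of Def. 2.4**:
`graphUnitHeppBound E = graphUnitHeppFlagSum E` [Panzer2022, Prop. 3.2 with Ex. 3.3 `H(K₄) = 84`].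

## Contents

* `isConnectedMatroid_cycleMatroid_of_isPrimitiveDivergent`,
* `graphSdc_four_one_pos` (unit indices in `D = 4` are in the convergence cone),
* **`graphUnitHeppBound_eq_graphUnitHeppFlagSum`**.
-/

noncomputable section

open Finset
open Literature.Combinatorics.Matroid

namespace Literature.MathematicalPhysics.QuantumFieldTheory

variable {N V : ℕ}

/-- **A primitive-divergent edge list has a connected cycle matroid** (Panzer 2022, proof of
Lemma 2.16: in a direct sum `ω` is additive, so `ω(E) = 0` forces `ω(A) ≤ 0` or `ω(B) ≤ 0` for a
separation `E = A ⊔ B`, contradicting primitivity `ω(γ) > 0` of the proper parts; rank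
additivity over the separation is `eRk_add_eRk_eq_eRank_of_eq_disjointSum`). [cite: Panzer2022, Lemma 2.16 (proof)] -/
theorem isConnectedMatroid_cycleMatroid_of_isPrimitiveDivergent
    (E : Fin N → Fin (V + 1) × Fin (V + 1)) (hp : IsPrimitiveDivergent E) :
    IsConnectedMatroid (cycleMatroid E) := by
  classical
  intro X hX hXne hXpr hM
  -- the two sides of the separation as finsets of edges
  set A : Finset (Fin N) := X.toFinset with hAdef
  have hA : (A : Set (Fin N)) = X := Set.coe_toFinset X
  have hAne : A.Nonempty := by
    obtain ⟨x, hx⟩ := hXne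
    exact ⟨x, Set.mem_toFinset.2 hx⟩
  have hApr : A ≠ Finset.univ := by
    intro h
    apply hXpr
    rw [← hA, h, Finset.coe_univ, cycleMatroid_ground]
  have hBne : (Finset.univ \ A).Nonempty := by
    rw [Finset.sdiff_nonempty]
    exact fun h => hApr (Finset.univ_subset_iff.1 h)
  have hBpr : Finset.univ \ A ≠ Finset.univ := by
    intro h
    obtain ⟨x, hx⟩ := hAne
    have : x ∈ Finset.univ \ A := by rw [h]; exact Finset.mem_univ x
    exact (Finset.mem_sdiff.1 this).2 hx
  -- the ranks, hence the loop numbers, are additive over the separation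
  have hr := eRk_add_eRk_eq_eRank_of_eq_disjointSum hX hM
  rw [Matroid.eRank_def, cycleMatroid_ground, ← hA, ← Finset.coe_univ, ← Finset.coe_sdiff] at hr
  have hfin : ∀ s : Finset (Fin N), (cycleMatroid E).eRk (s : Set (Fin N)) ≠ ⊤ := fun s =>
    ne_top_of_le_ne_top (ENat.coe_ne_top s.card)
      (by rw [← Set.encard_coe_eq_coe_finsetCard]; exact (cycleMatroid E).eRk_le_encard _)
  have hr' : ((cycleMatroid E).eRk (A : Set (Fin N))).toNat +
      ((cycleMatroid E).eRk ((Finset.univ \ A : Finset (Fin N)) : Set (Fin N))).toNat =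
        ((cycleMatroid E).eRk ((Finset.univ : Finset (Fin N)) : Set (Fin N))).toNat := by
    have := congr_arg ENat.toNat hr
    rwa [ENat.toNat_add (hfin _) (hfin _)] at this
  have hA' := eRk_toNat_add_corank (cycleMatroid E) A
  have hB' := eRk_toNat_add_corank (cycleMatroid E) (Finset.univ \ A)
  have hE' := eRk_toNat_add_corank (cycleMatroid E) Finset.univ
  rw [corank_cycleMatroid] at hA' hB' hE'
  -- primitivity of the two proper parts versus logarithmic divergence of the whole
  obtain ⟨hlog, hprim⟩ := hp
  have h1 := hprim A hAne hApr
  have h2 := hprim (Finset.univ \ A) hBne hBpr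
  have hcard : (Finset.univ \ A).card + A.card = (Finset.univ : Finset (Fin N)).card :=
    Finset.card_sdiff_add_card_eq_card (Finset.subset_univ A)
  rw [Finset.card_univ, Fintype.card_fin] at hcard hE'
  omega

/-- **Unit indices in `D = 4` are off the poles of a primitive-divergent graph**: for every
non-empty proper edge set `γ`, `ω(γ) = |γ| - 2 h₁(γ) > 0` (the convergence cone `Λ` of
Panzer 2022, Prop. 2.9; Brown 2009, Def. 4). [cite: Panzer2022, Prop. 2.9 (convergence cone)] -/
theorem graphSdc_four_one_pos (E : Fin N → Fin (V + 1) × Fin (V + 1)) (hp : IsPrimitiveDivergent E)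
    (γ : Finset (Fin N)) (hne : γ.Nonempty) (hpr : γ ≠ Finset.univ) :
    0 < graphSdc E (4 : ℚ) (fun _ => 1) γ := by
  have h := hp.2 γ hne hpr
  rw [graphSdc_apply, Finset.sum_const, nsmul_eq_mul, mul_one]
  have : ((2 * loopNumber E γ : ℕ) : ℚ) < (γ.card : ℚ) := by exact_mod_cast h
  push_cast at this
  linarith

/-- **The inlined flag formula computes the Hepp bound** (Panzer 2022, Prop. 3.2, now a theorem
of the tree, specialised to graphs): for a primitive-divergent edge list, the unit-index `D = 4`
bridgeless-flag sum of the route `PhiFourLaboratory` equals `H(G)` of Def. 2.4 — e.g.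
`H(K₄) = 84` (Ex. 3.3) on both sides. [cite: Panzer2022, Prop. 3.2] -/
theorem graphUnitHeppBound_eq_graphUnitHeppFlagSum {n : ℕ} (E : Fin (n + 1) → Fin (V + 1) × Fin (V + 1))
    (hp : IsPrimitiveDivergent E) : graphUnitHeppBound E = graphUnitHeppFlagSum E := by
  have hl : 1 ≤ loopNumber E Finset.univ := by
    have := hp.1
    omega
  exact graphHeppBoundDim_eq_graphHeppFlagSum Panzer2022_prop_3_2_holds E
    (isConnectedMatroid_cycleMatroid_of_isPrimitiveDivergent E hp) hl (4 : ℚ) (fun _ => 1)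
    (fun γ hne hpr => (graphSdc_four_one_pos E hp γ hne hpr).ne') (fun _ => one_ne_zero)

end Literature.MathematicalPhysics.QuantumFieldTheory
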